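import Summits.CriticalPhenomena.SAWScalingLimit.Theorems.SAWTensorRGRestrictionOfLimitSqueezeModel
import Literature.Topology.PlaneTopology.SimpleArcs
import HarnessLib

/-!
# Outer squeezes, part 3: bites in the half-plane model

Support file (`--supports stmt-CriticalPhenomena-0773`, towards the registered stub `stub_squeezeFamily`) of
the line `birth` for the crux `RestrictionOfLimit`. Pure plane topology, no probability.

For a symmetric chart `g : U → 𝔻` (`SymChart`, part 2) of a conjugation-symmetric open set `U` (a
component of the reflected defect) the **bite of radius `r ∈ (0, 1)`** is
`bite g r = g⁻¹(closed disc of radius r) ∩ ℍ̄`, a compact subset of `U ∩ ℍ̄`; its part in `ℍ` off the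
**cut** `cut g r = g⁻¹(upper semicircle of radius r)` is the nonempty open connected set
`biteInt g r = g⁻¹(open upper half-disc of radius r)`; the cut is a simple arc between the two real points
`g⁻¹(±r)`, which are adherent to `biteInt g r`; bites increase with `r` with collars
(`exists_nhds_subset_bite`) and exhaust `U ∩ ℍ̄` as `r ↑ 1`. These are exactly the hypotheses of the bite
lemma of part 1, read in the model. Axioms `propext`, `Classical.choice`, `Quot.sound`.
-/

noncomputable section

open Set Filter Topology Metric Complex Bornology
open scoped ComplexConjugate Real
open Literature.Probability.RandomPlanarGeometry Literature.Topology.PlaneTopology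

namespace Summit.CriticalPhenomena.SAWScalingLimit.Theorems.RestrictionOfLimit.Birth

namespace SymChart

variable {U : Set ℂ} (g : SymChart U)

/-- A symmetric chart is injective. [folklore] -/
theorem injOn : InjOn g.toFun U := fun z hz w hw h ↦ by
  rw [← g.left_inv z hz, ← g.left_inv w hw, h]

/-- The inverse chart is injective on the disc. [folklore] -/
theorem injOn_inv : InjOn g.invFun (ball 0 1) := fun z hz w hw h ↦ by
  rw [← g.right_inv z hz, ← g.right_inv w hw, h]

/-- Real points correspond to real values (for symmetric `U`). [folklore] -/
theorem im_eq_zero_iff (hU : ∀ z ∈ U, conj z ∈ U) {z : ℂ} (hz : z ∈ U) :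
    z.im = 0 ↔ (g.toFun z).im = 0 := by
  refine ⟨fun h ↦ ?_, im_eq_zero_of_map_conj g.injOn hU g.map_conj hz⟩
  have h1 : g.toFun z = conj (g.toFun z) := by
    rw [← g.map_conj z hz, conj_eq_iff_im.2 h]
  exact conj_eq_iff_im.1 h1.symm

/-- The closed upper part of `U` corresponds to the closed upper half-disc (for symmetric `U`). [folklore] -/
theorem im_nonneg_iff (hU : ∀ z ∈ U, conj z ∈ U) {z : ℂ} (hz : z ∈ U) :
    0 ≤ z.im ↔ 0 ≤ (g.toFun z).im := by
  have h := g.im_pos_iff (conj z) (hU z hz)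
  rw [g.map_conj z hz, conj_im, conj_im] at h
  constructor
  · intro h0
    by_contra h1
    have : 0 < -(g.toFun z).im := by linarith [not_le.1 h1]
    linarith [h.2 this]
  · intro h0
    by_contra h1
    have : 0 < -z.im := by linarith [not_le.1 h1]
    linarith [h.1 this]

/-- An image under the inverse chart, read through the chart. [folklore] -/
theorem image_inv_eq {S : Set ℂ} (hS : S ⊆ ball 0 1) : g.invFun '' S = {z | z ∈ U ∧ g.toFun z ∈ S} := by
  ext z
  constructor
  · rintro ⟨w, hw, rfl⟩
    exact ⟨g.mapsTo_inv (hS hw), by rw [g.right_inv w (hS hw)]; exact hw⟩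
  · rintro ⟨hz, hzS⟩
    exact ⟨g.toFun z, hzS, g.left_inv z hz⟩

/-- The **bite** of radius `r`: `g⁻¹(closed disc of radius r) ∩ ℍ̄`. [folklore] -/
def bite (r : ℝ) : Set ℂ := g.invFun '' (closedBall 0 r ∩ {w | 0 ≤ w.im})

/-- The **open bite**: `g⁻¹(open upper half-disc of radius r)`. [folklore] -/
def biteInt (r : ℝ) : Set ℂ := g.invFun '' (ball 0 r ∩ {w | 0 < w.im})

/-- The **cut** of the bite: `g⁻¹(closed upper semicircle of radius r)`. [folklore] -/
def cut (r : ℝ) : Set ℂ := g.invFun '' (sphere 0 r ∩ {w | 0 ≤ w.im})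

variable {r : ℝ}

/-- Membership in the bite. [folklore] -/
theorem mem_bite_iff (hU : ∀ z ∈ U, conj z ∈ U) (hr1 : r < 1) {z : ℂ} :
    z ∈ g.bite r ↔ z ∈ U ∧ ‖g.toFun z‖ ≤ r ∧ 0 ≤ z.im := by
  rw [bite, g.image_inv_eq (inter_subset_left.trans (closedBall_subset_ball hr1))]
  simp only [mem_setOf_eq, mem_inter_iff, mem_closedBall_zero_iff]
  constructor
  · rintro ⟨hz, h1, h2⟩; exact ⟨hz, h1, (g.im_nonneg_iff hU hz).2 h2⟩
  · rintro ⟨hz, h1, h2⟩; exact ⟨hz, h1, (g.im_nonneg_iff hU hz).1 h2⟩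

/-- Membership in the open bite. [folklore] -/
theorem mem_biteInt_iff (hr1 : r < 1) {z : ℂ} :
    z ∈ g.biteInt r ↔ z ∈ U ∧ ‖g.toFun z‖ < r ∧ 0 < z.im := by
  rw [biteInt, g.image_inv_eq (inter_subset_left.trans (ball_subset_ball hr1.le))]
  simp only [mem_setOf_eq, mem_inter_iff, mem_ball_zero_iff]
  constructor
  · rintro ⟨hz, h1, h2⟩; exact ⟨hz, h1, (g.im_pos_iff z hz).2 h2⟩
  · rintro ⟨hz, h1, h2⟩; exact ⟨hz, h1, (g.im_pos_iff z hz).1 h2⟩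

/-- Membership in the cut. [folklore] -/
theorem mem_cut_iff (hU : ∀ z ∈ U, conj z ∈ U) (hr1 : r < 1) {z : ℂ} :
    z ∈ g.cut r ↔ z ∈ U ∧ ‖g.toFun z‖ = r ∧ 0 ≤ z.im := by
  rw [cut, g.image_inv_eq (inter_subset_left.trans (sphere_subset_ball hr1))]
  simp only [mem_setOf_eq, mem_inter_iff, mem_sphere_zero_iff_norm]
  constructor
  · rintro ⟨hz, h1, h2⟩; exact ⟨hz, h1, (g.im_nonneg_iff hU hz).2 h2⟩
  · rintro ⟨hz, h1, h2⟩; exact ⟨hz, h1, (g.im_nonneg_iff hU hz).1 h2⟩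

/-- Bites are compact. [folklore] -/
theorem isCompact_bite (hr1 : r < 1) : IsCompact (g.bite r) :=
  ((isCompact_closedBall 0 r).inter_right (isClosed_le continuous_const continuous_im)).image_of_continuousOn
    (g.continuousOn_inv.mono (inter_subset_left.trans (closedBall_subset_ball hr1)))

/-- Bites lie in `U ∩ ℍ̄`. [folklore] -/
theorem bite_subset (hU : ∀ z ∈ U, conj z ∈ U) (hr1 : r < 1) : g.bite r ⊆ U ∩ {z | 0 ≤ z.im} :=
  fun _ hz ↦ ⟨((g.mem_bite_iff hU hr1).1 hz).1, ((g.mem_bite_iff hU hr1).1 hz).2.2⟩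

/-- The cut lies in the bite. [folklore] -/
theorem cut_subset_bite : g.cut r ⊆ g.bite r :=
  image_mono (inter_subset_inter_left _ sphere_subset_closedBall)

/-- The open bite lies in the bite. [folklore] -/
theorem biteInt_subset_bite : g.biteInt r ⊆ g.bite r :=
  image_mono (inter_subset_inter ball_subset_closedBall
    (fun w (hw : 0 < w.im) ↦ (hw.le : 0 ≤ w.im)))

/-- The open bite is open (for open `U`). [folklore] -/
theorem isOpen_biteInt (hUo : IsOpen U) (hr1 : r < 1) : IsOpen (g.biteInt r) := by
  rw [biteInt, g.image_inv_eq (inter_subset_left.trans (ball_subset_ball hr1.le))]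
  exact g.continuousOn.isOpen_inter_preimage hUo
    (isOpen_ball.inter (isOpen_lt continuous_const continuous_im))

/-- The open bite is connected (and nonempty) for `0 < r < 1`. [folklore] -/
theorem isConnected_biteInt (hr : 0 < r) (hr1 : r < 1) : IsConnected (g.biteInt r) := by
  have hne : (ball (0 : ℂ) r ∩ {w | 0 < w.im}).Nonempty :=
    ⟨(r / 2 : ℝ) * I, by simp [abs_of_pos hr]; linarith, by simp [hr]⟩
  have hc : IsConnected (ball (0 : ℂ) r ∩ {w | 0 < w.im}) :=
    (((convex_ball (0 : ℂ) r).inter (convex_halfSpace_im_gt 0)).isPathConnected hne).isConnected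
  exact hc.image _ (g.continuousOn_inv.mono (inter_subset_left.trans (ball_subset_ball hr1.le)))

/-- The part of the bite in `ℍ` off the cut is the open bite. [folklore] -/
theorem bite_inter_diff_cut (hU : ∀ z ∈ U, conj z ∈ U) (hr1 : r < 1) :
    (g.bite r ∩ {z | 0 < z.im}) \ g.cut r = g.biteInt r := by
  ext z
  rw [Set.mem_sdiff, mem_inter_iff, g.mem_bite_iff hU hr1, g.mem_cut_iff hU hr1, g.mem_biteInt_iff hr1]
  simp only [mem_setOf_eq]
  constructor
  · rintro ⟨⟨⟨hz, h1, h2⟩, h3⟩, h4⟩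
    exact ⟨hz, lt_of_le_of_ne h1 fun h ↦ h4 ⟨hz, h, h2⟩, h3⟩
  · rintro ⟨hz, h1, h2⟩
    exact ⟨⟨⟨hz, h1.le, h2.le⟩, h2⟩, fun h ↦ h1.ne h.2.1⟩

/-- Real values of the inverse chart on the real diameter. [folklore] -/
theorem invFun_ofReal_im (hU : ∀ z ∈ U, conj z ∈ U) {x : ℝ} (hx : |x| < 1) : (g.invFun x).im = 0 := by
  have hxb : (x : ℂ) ∈ ball (0 : ℂ) 1 := by simpa using hx
  rw [g.im_eq_zero_iff hU (g.mapsTo_inv hxb), g.right_inv _ hxb, ofReal_im]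

/-! ### The cut is a simple arc -/

/-- The upper semicircle of radius `r`, parametrised on `[0, 1]`. [folklore] -/
def semi (r : ℝ) (θ : ℝ) : ℂ := (r : ℂ) * exp (((π * θ : ℝ) : ℂ) * I)

/-- `‖semi r θ‖ = r` for `r ≥ 0`. [folklore] -/
theorem norm_semi (hr : 0 ≤ r) (θ : ℝ) : ‖semi r θ‖ = r := by
  rw [semi, norm_mul, norm_exp_ofReal_mul_I, mul_one, Complex.norm_real, Real.norm_eq_abs, abs_of_nonneg hr]

/-- `im (semi r θ) = r sin (π θ)`. [folklore] -/
theorem semi_im (r θ : ℝ) : (semi r θ).im = r * Real.sin (π * θ) := by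
  rw [semi, im_ofReal_mul, exp_ofReal_mul_I_im]

/-- The semicircle parametrises `sphere 0 r ∩ ℍ̄` injectively. [folklore] -/
theorem semi_image (hr : 0 < r) : semi r '' Icc 0 1 = sphere (0 : ℂ) r ∩ {w | 0 ≤ w.im} := by
  apply Subset.antisymm
  · rintro _ ⟨θ, hθ, rfl⟩
    refine ⟨mem_sphere_zero_iff_norm.2 (norm_semi hr.le θ), ?_⟩
    show 0 ≤ (semi r θ).im
    rw [semi_im]
    exact mul_nonneg hr.le (Real.sin_nonneg_of_nonneg_of_le_pi (mul_nonneg Real.pi_pos.le hθ.1)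
      (by nlinarith [hθ.2, Real.pi_pos]))
  · rintro v ⟨hv, hv'⟩
    have hvn : ‖v‖ = r := mem_sphere_zero_iff_norm.1 hv
    refine ⟨arg v / π, ⟨div_nonneg (arg_nonneg_iff.2 hv') Real.pi_pos.le,
      (div_le_one Real.pi_pos).2 (arg_le_pi v)⟩, ?_⟩
    rw [semi, mul_div_cancel₀ _ Real.pi_pos.ne', ← hvn]
    exact norm_mul_exp_arg_mul_I v

/-- The semicircle parametrisation is injective on `[0, 1]`. [folklore] -/
theorem injOn_semi (hr : 0 < r) : InjOn (semi r) (Icc 0 1) := by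
  intro s hs t ht h
  have h1 : exp (((π * s : ℝ) : ℂ) * I) = exp (((π * t : ℝ) : ℂ) * I) :=
    mul_left_cancel₀ (by exact_mod_cast hr.ne') h
  have h2 : Real.cos (π * s) = Real.cos (π * t) := by
    rw [← exp_ofReal_mul_I_re, ← exp_ofReal_mul_I_re, h1]
  have h3 := Real.injOn_cos ⟨by nlinarith [hs.1, Real.pi_pos], by nlinarith [hs.2, Real.pi_pos]⟩
    ⟨by nlinarith [ht.1, Real.pi_pos], by nlinarith [ht.2, Real.pi_pos]⟩ h2
  exact mul_left_cancel₀ Real.pi_pos.ne' h3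

/-- **The cut is a simple arc** from `g⁻¹(r)` to `g⁻¹(-r)`. [folklore] -/
theorem isSimpleArc_cut (hr : 0 < r) (hr1 : r < 1) : IsSimpleArc (g.cut r) (g.invFun r) (g.invFun (-r)) := by
  have hsemi : ∀ θ, semi r θ ∈ ball (0 : ℂ) 1 := fun θ ↦ by
    rw [mem_ball_zero_iff, norm_semi hr.le]; exact hr1
  have hcont : Continuous (semi r) := by unfold semi; fun_prop
  refine ⟨fun θ ↦ g.invFun (semi r θ), g.continuousOn_inv.comp_continuous hcont hsemi |>.continuousOn,
    ?_, ?_, ?_, ?_⟩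
  · intro s hs t ht h
    exact injOn_semi hr hs ht (g.injOn_inv (hsemi s) (hsemi t) h)
  · rw [cut, ← semi_image hr, image_image]
  · show g.invFun (semi r 0) = g.invFun r
    simp [semi]
  · show g.invFun (semi r 1) = g.invFun (-r)
    simp [semi, exp_pi_mul_I]

/-! ### End-points of the cut are adherent to the open bite -/

/-- `±r` is adherent to the open upper half-disc of radius `r`. [folklore] -/
theorem ofReal_mem_closure_halfBall (hr : 0 < r) {σ : ℝ} (hσ : σ = 1 ∨ σ = -1) :
    ((σ * r : ℝ) : ℂ) ∈ closure (ball (0 : ℂ) r ∩ {w | 0 < w.im}) := by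
  set w : ℝ → ℂ := fun t ↦ ((σ * r * (1 - t) : ℝ) : ℂ) + ((r * t / 2 : ℝ) : ℂ) * I with hw
  have hσ2 : σ ^ 2 = 1 := by rcases hσ with rfl | rfl <;> norm_num
  have hcont : Continuous w := by rw [hw]; fun_prop
  have htend : Tendsto w (𝓝[>] 0) (𝓝 (((σ * r : ℝ) : ℂ))) := by
    have := (hcont.tendsto 0).mono_left (nhdsWithin_le_nhds (s := Ioi (0 : ℝ)))
    convert this using 2
    simp [hw]
  refine mem_closure_of_tendsto htend ?_
  filter_upwards [Ioo_mem_nhdsGT zero_lt_one] with t ht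
  refine ⟨?_, ?_⟩
  · rw [mem_ball_zero_iff, hw]
    simp only
    rw [norm_add_mul_I, Real.sqrt_lt' hr]
    have h1 : (σ * r * (1 - t)) ^ 2 = r ^ 2 * (1 - t) ^ 2 := by
      rw [show (σ * r * (1 - t)) ^ 2 = σ ^ 2 * (r ^ 2 * (1 - t) ^ 2) by ring, hσ2, one_mul]
    have h2 : 0 < r ^ 2 * t * (2 - 5 * t / 4) :=
      mul_pos (mul_pos (pow_pos hr 2) ht.1) (by linarith [ht.2])
    nlinarith [h1, h2]
  · show 0 < (w t).im
    have h2 : (w t).im = r * t / 2 := by simp [hw]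
    rw [h2]
    exact div_pos (mul_pos hr ht.1) two_pos

/-- The end-points `g⁻¹(±r)` of the cut lie in the closure of the open bite. [folklore] -/
theorem invFun_mem_closure_biteInt (hr : 0 < r) (hr1 : r < 1) {σ : ℝ} (hσ : σ = 1 ∨ σ = -1) :
    g.invFun ((σ * r : ℝ) : ℂ) ∈ closure (g.biteInt r) := by
  have hmem : ((σ * r : ℝ) : ℂ) ∈ ball (0 : ℂ) 1 := by
    rw [mem_ball_zero_iff, Complex.norm_real, Real.norm_eq_abs, abs_mul]
    rcases hσ with rfl | rfl <;> simp [abs_of_pos hr, hr1]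
  refine ContinuousWithinAt.mem_closure_image ?_ (ofReal_mem_closure_halfBall hr hσ)
  exact (g.continuousOn_inv.continuousWithinAt hmem).mono (inter_subset_left.trans (ball_subset_ball hr1.le))

/-! ### Collars and exhaustion -/

/-- **Collars / exhaustion.** A point `z ∈ U` with `‖g z‖ < r` has a neighbourhood whose closed-upper part
lies in the bite of radius `r`. Applied to points of `bite g s`, `s < r`, this is the collar property; applied
to an arbitrary `z ∈ U ∩ ℍ̄` with `r ∈ (‖g z‖, 1)` it is exhaustion. [folklore] -/
theorem exists_nhds_subset_bite (hU : ∀ z ∈ U, conj z ∈ U) (hUo : IsOpen U) (hr1 : r < 1) {z : ℂ}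
    (hz : z ∈ U) (hzr : ‖g.toFun z‖ < r) :
    ∃ V : Set ℂ, IsOpen V ∧ z ∈ V ∧ V ∩ {w | 0 ≤ w.im} ⊆ g.bite r := by
  refine ⟨U ∩ g.toFun ⁻¹' ball 0 r, g.continuousOn.isOpen_inter_preimage hUo isOpen_ball,
    ⟨hz, mem_ball_zero_iff.2 hzr⟩, ?_⟩
  rintro w ⟨⟨hwU, hwr⟩, hwim⟩
  exact (g.mem_bite_iff hU hr1).2 ⟨hwU, (mem_ball_zero_iff.1 hwr).le, hwim⟩

/-- On the cut, only the two end-points are real. [folklore] -/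
theorem eq_endpoints_of_mem_cut (hU : ∀ z ∈ U, conj z ∈ U) (hr : 0 < r) (hr1 : r < 1) {z : ℂ}
    (hz : z ∈ g.cut r) (hzim : z.im = 0) : z = g.invFun r ∨ z = g.invFun (-r) := by
  obtain ⟨hzU, hzr, -⟩ := (g.mem_cut_iff hU hr1).1 hz
  have him : (g.toFun z).im = 0 := (g.im_eq_zero_iff hU hzU).1 hzim
  have hre : |(g.toFun z).re| = r := by
    have h := hzr
    rw [← re_add_im (g.toFun z), him] at h
    simpa using h
  have hz' : z = g.invFun (g.toFun z) := (g.left_inv z hzU).symm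
  have hgz : g.toFun z = ((g.toFun z).re : ℂ) := by
    rw [← re_add_im (g.toFun z), him]; simp
  rcases (abs_eq hr.le).1 hre with h | h
  · left
    rw [hz', hgz, h]
  · right
    rw [hz', hgz, h, ofReal_neg]

end SymChart

/-- **Bite data of a component.** For a real point `x` of the reflected defect, the component `comp Kb x`
carries bites `B r` (`0 < r < 1`) with cuts `L r` from `p r` to `q r` and open bites `Bi r` having all the
properties needed by the bite lemma of part 1 and by the squeeze (collars, exhaustion), read in the model:
take the bites of a symmetric chart (`nonempty_symChart`). [folklore] -/
theorem exists_biteData {Kb : Set ℂ} (hK : IsClosed Kb) (hKH : Kb ⊆ {z | 0 ≤ z.im}) (hKc : IsPreconnected Kb)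
    (hunb : ¬ IsBounded Kb) (hreal : ∃ x : ℝ, (x : ℂ) ∈ Kb) {x : ℝ} (hx : (x : ℂ) ∈ hat Kb) :
    ∃ (B Bi L : ℝ → Set ℂ) (p q : ℝ → ℂ),
      (∀ r : ℝ, 0 < r → r < 1 →
        IsCompact (B r) ∧ B r ⊆ comp Kb x ∩ {z | 0 ≤ z.im} ∧ L r ⊆ B r ∧ IsSimpleArc (L r) (p r) (q r) ∧
        (p r).im = 0 ∧ (q r).im = 0 ∧ p r ∈ closure (Bi r) ∧ q r ∈ closure (Bi r) ∧
        (B r ∩ {z | 0 < z.im}) \ L r = Bi r ∧ IsOpen (Bi r) ∧ IsConnected (Bi r) ∧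
        Bi r ⊆ {z | 0 < z.im} ∧ (∀ z ∈ L r, z.im = 0 → z = p r ∨ z = q r) ∧
        (∀ r' : ℝ, r < r' → r' < 1 → ∀ z ∈ B r, ∃ V : Set ℂ, IsOpen V ∧ z ∈ V ∧
          V ∩ {w | 0 ≤ w.im} ⊆ B r')) ∧
      (∀ z ∈ comp Kb x, 0 ≤ z.im → ∃ r₀ : ℝ, r₀ < 1 ∧ ∀ r' : ℝ, r₀ < r' → r' < 1 →
        ∃ V : Set ℂ, IsOpen V ∧ z ∈ V ∧ V ∩ {w | 0 ≤ w.im} ⊆ B r') := by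
  obtain ⟨g⟩ := nonempty_symChart hK hKH hKc hunb hreal hx
  have hU : ∀ z ∈ comp Kb x, conj z ∈ comp Kb x := fun z hz ↦ conj_mem_comp hz
  have hUo : IsOpen (comp Kb x) := isOpen_comp hK x
  refine ⟨g.bite, g.biteInt, g.cut, fun r ↦ g.invFun r, fun r ↦ g.invFun (-r), fun r hr hr1 ↦
    ⟨g.isCompact_bite hr1, g.bite_subset hU hr1, g.cut_subset_bite, g.isSimpleArc_cut hr hr1, ?_, ?_, ?_, ?_,
      g.bite_inter_diff_cut hU hr1, g.isOpen_biteInt hUo hr1, g.isConnected_biteInt hr hr1,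
      fun z hz ↦ ((g.mem_biteInt_iff hr1).1 hz).2.2, fun z hz hzim ↦ g.eq_endpoints_of_mem_cut hU hr hr1 hz hzim,
      fun r' hrr' hr'1 z hz ↦ g.exists_nhds_subset_bite hU hUo hr'1 ((g.mem_bite_iff hU hr1).1 hz).1
        (lt_of_le_of_lt ((g.mem_bite_iff hU hr1).1 hz).2.1 hrr')⟩, fun z hz hzim ↦ ?_⟩
  · exact g.invFun_ofReal_im hU (by rw [abs_of_pos hr]; exact hr1)
  · have := g.invFun_ofReal_im hU (x := -r) (by rw [abs_neg, abs_of_pos hr]; exact hr1)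
    rwa [ofReal_neg] at this
  · have := g.invFun_mem_closure_biteInt hr hr1 (σ := 1) (Or.inl rfl)
    rwa [one_mul] at this
  · have := g.invFun_mem_closure_biteInt hr hr1 (σ := -1) (Or.inr rfl)
    rwa [neg_one_mul, ofReal_neg] at this
  · refine ⟨‖g.toFun z‖, mem_ball_zero_iff.1 (g.mapsTo hz), fun r' hr₀ hr'1 ↦ ?_⟩
    exact g.exists_nhds_subset_bite hU hUo hr'1 hz hr₀

/-- **Registered helper stub `stub_squeezeBiteData`** (towards `stub_squeezeFamily`, line `birth`): existence
of exhausting bite data with collars on each component of the reflected defect, in closed form. [folklore] -/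
theorem stub_squeezeBiteData :
    ∀ (Kb : Set ℂ) (x : ℝ), IsClosed Kb → Kb ⊆ {z | 0 ≤ z.im} → IsPreconnected Kb → ¬ Bornology.IsBounded Kb →
      (∃ y : ℝ, (y : ℂ) ∈ Kb) →
      (x : ℂ) ∈ Summit.CriticalPhenomena.SAWScalingLimit.Theorems.RestrictionOfLimit.Birth.hat Kb →
      ∃ B : ℝ → Set ℂ, (∀ r : ℝ, 0 < r → r < 1 → IsCompact (B r) ∧
        B r ⊆ Summit.CriticalPhenomena.SAWScalingLimit.Theorems.RestrictionOfLimit.Birth.comp Kb x ∩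
          {z | 0 ≤ z.im}) ∧
        (∀ z ∈ Summit.CriticalPhenomena.SAWScalingLimit.Theorems.RestrictionOfLimit.Birth.comp Kb x,
          0 ≤ z.im → ∃ r₀ : ℝ, r₀ < 1 ∧ ∀ r' : ℝ, r₀ < r' → r' < 1 →
          ∃ V : Set ℂ, IsOpen V ∧ z ∈ V ∧ V ∩ {w | 0 ≤ w.im} ⊆ B r') := by
  intro Kb x hK hKH hKc hunb hreal hx
  obtain ⟨B, _Bi, _L, _p, _q, h1, h2⟩ := exists_biteData hK hKH hKc hunb hreal hx
  exact ⟨B, fun r hr hr1 ↦ ⟨(h1 r hr hr1).1, (h1 r hr hr1).2.1⟩, h2⟩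

end Summit.CriticalPhenomena.SAWScalingLimit.Theorems.RestrictionOfLimit.Birth

end
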